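import Summits.BirchSwinnertonDyer.Rank1Residual.Additive.X4RankZeroVisibleRefinedCertificate
import Summits.BirchSwinnertonDyer.Rank1Residual.Additive.X4RankZeroVisibleLowerBoundPlacesSix
import Summits.BirchSwinnertonDyer.Rank1Residual.Additive.LocalTowerKernelAtPTwistedOrdinary
import HarnessLib

/-!
# Record sockets over the REFINED seven-kind visibility certificate, prime-list form
# (cell `b2b-bsdres`, team n1011, row T-2LL FILE 6 = the sockets the PASS⁺ / D44 / K44 records
# elaborate against; seat p04 GEN 11; lead R5-86 (r) "T-NSK-REC pilot over the refined END" / R5-87)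

HONEST FRAMING (cell `b2b-bsdres`, run/shared/lean/b2b/bsd-rank1-residual/, verbatim in every
file): the goal of the cell is to DELETE the COMBINATION-SHAPED residual classes of the
Birch–Swinnerton-Dyer formula for ALL analytic-rank `≤ 1` elliptic curves over `ℚ` — "full BSD
formula for every rank `≤ 1` curve in class `C`" assembled STRICTLY from published theorems — so
that the rank-`≤ 1` remainder becomes exactly the CONSTRUCTION-SHAPED classes, which are TYPED
(missing-input `Prop`s), NOT attempted. This is not "finishing BSD". Team n1011 (N10 / N11, the
additive block X4 ∧ `p = 3`): research route on the CONSTRUCTION-SHAPED class X4; no claim beyond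
the stated classes; nothing is booked; no mark / label / count is changed by this file. Theorems
only (no definition, no new named fact, no `sorry`). The sockets are CONDITIONAL on the displayed
named facts of the X4 ∧ `r = 0` ENDs (FILE 5) and CLOSE NOTHING by themselves: a per-row RECORD
discharges `θ`, the integer models and discriminant supports, `#E′(ℚ₃)[3] ≤ t` and every disjunct of
`hplaces` in the kernel, and carries `hr`, `hq`/`hv`, `hrank` as EVIDENCE binders (ruling of record
for row shapes, n1011 lead R5-82 (d)).

## What

n1011-p14's T-VIS3-TATE socket `X4RankZero.bsdp_three_potMult_of_congr_of_places₆_of_primeList`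
(`X4RankZeroVisibleLowerBoundPlacesSix.lean`) serves `T = ∅` over the six kinds. Here, over FILE 5's
ENDs `X4RankZero.bsdp_three_[potMult_]of_congr_of_places₇[_of_kato]` (seven kinds, (vii) = both
curves additive at `w ∤ 3` with `#E′(ℚ_w)[3] = 3`, T-2LL FILE 3):

* `exists_paidPlace_three` — plumbing: `T = {v₃}` inside the places `S` over a list `L ∋ 3`, with the
  crude factor `#E′(ℚ₃)[3] · #(ℤ₃/3ℤ₃) ≤ 3t < 3^k ≤ 3^{rank E′}`;
* `X4RankZero.bsdp_three_potMult_of_congr_of_places₇_of_primeList` — (M) rows, no paid place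
  (`1 ≤ rank E′`);
* `X4RankZero.bsdp_three_potMult_of_congr_of_places₇_of_primeList_paidThree` — (M) rows, the place
  `3` paid (route planner 1's PASS⁺ shape: `t₃ = 1`, one (iv′) place, `rank E′ = 2`: `3·1 < 3²`);
* `X4RankZero.bsdp_three_of_congr_of_places₇_of_kato_of_primeList_paidThree` — potentially good rows
  (Kato's upper half), the place `3` paid.

References: [CremonaMazur2000] §3 and Table 1; [AgasheStein2002] Thm. 3.1; [Kato2004Asterisque]
Thm. 14.5; [Delbourgo1998] Prop. 4; [SilvermanAEC2009] VII.5.1, X.4.2, X.4.14; [SilvermanATAEC1994]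
Ch. V; cells/n1011/ROUTE-1.md §41.9, §44.
-/

set_option autoImplicit false

noncomputable section

open scoped Classical NumberField
open IsDedekindDomain NumberField WeierstrassCurve Rat.HeightOneSpectrum
  Literature.NumberTheory.EllipticCurves Literature.NumberTheory.EllipticCurves.ModularForms
  Literature.NumberTheory.EllipticCurves.Rank1Residual
  Literature.NumberTheory.EllipticCurves.Rank1Residual.Typed
  Literature.NumberTheory.GaloisRepresentations
  Summit.BirchSwinnertonDyer.Rank1Residual.GaloisImage

namespace Summit.BirchSwinnertonDyer.Rank1Residual.Additive

/-! ### §1. Records plumbing: the place `3` as the single PAID place -/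

/-- **The single paid place `3`** (records plumbing, no content): with `S` the places over a list
`L ∋ 3`, the set `T = {v₃}` (`v₃` the place of `3`) satisfies `T ⊆ S`, every `w ∈ S ∖ T` has
`ℓ_w ≠ 3`, and the crude factor on `T` is `#E′(ℚ₃)[3] · #(ℤ₃/3ℤ₃) ≤ 3t < 3^k ≤ 3^{rank E′}`
(`#(ℤ₃/3ℤ₃) = 3`: `GoodModelLine.natCard_adicCompletionIntegers_quot_span_eq`). [folklore] -/
theorem exists_paidPlace_three (W' : WeierstrassCurve ℚ) (L : List ℕ) (h3L : 3 ∈ L)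
    {S : Finset (HeightOneSpectrum (𝓞 ℚ))}
    (hS : ∀ v : HeightOneSpectrum (𝓞 ℚ), v ∈ S ↔ (primesEquiv v : ℕ) ∈ L) {t k : ℕ}
    (htors₃ : ∀ w : HeightOneSpectrum (𝓞 ℚ), (primesEquiv w : ℕ) = 3 →
      Nat.card (nsmulAddMonoidHom 3 :
        (W'.baseChange (w.adicCompletion ℚ)).toAffine.Point →+ _).ker ≤ t)
    (hbudget : 3 * t < 3 ^ k) (hrank : k ≤ W'.mordellWeilRank) :
    ∃ T : Finset (HeightOneSpectrum (𝓞 ℚ)), T ⊆ S ∧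
      (∏ w ∈ T, Nat.card (nsmulAddMonoidHom 3 :
        (W'.baseChange (w.adicCompletion ℚ)).toAffine.Point →+ _).ker *
        Nat.card (w.adicCompletionIntegers ℚ ⧸
          Ideal.span {((3 : ℕ) : w.adicCompletionIntegers ℚ)})) < 3 ^ W'.mordellWeilRank ∧
      ∀ w ∈ S, w ∉ T → (primesEquiv w : ℕ) ≠ 3 := by
  haveI : Fact (Nat.Prime 3) := ⟨Nat.prime_three⟩
  set v₃ : HeightOneSpectrum (𝓞 ℚ) := (primesEquiv (R := 𝓞 ℚ)).symm ⟨3, Nat.prime_three⟩ with hv₃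
  have hℓ₃ : (primesEquiv v₃ : ℕ) = 3 := by rw [hv₃, Equiv.apply_symm_apply]
  have h3v₃ : ((3 : ℕ) : 𝓞 ℚ) ∈ v₃.asIdeal :=
    (natCast_mem_asIdeal_iff_eq_primesEquiv_symm v₃ Nat.prime_three).mpr hv₃
  refine ⟨{v₃}, Finset.singleton_subset_iff.mpr ((hS v₃).mpr (by rw [hℓ₃]; exact h3L)), ?_,
    fun w _ hw h3 ↦ hw ?_⟩
  · rw [Finset.prod_singleton, GoodModelLine.natCard_adicCompletionIntegers_quot_span_eq h3v₃]
    calc _ ≤ t * 3 := Nat.mul_le_mul_right 3 (htors₃ v₃ hℓ₃)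
      _ < 3 ^ k := by rw [mul_comm]; exact hbudget
      _ ≤ 3 ^ W'.mordellWeilRank := Nat.pow_le_pow_right (by norm_num) hrank
  · rw [Finset.mem_singleton]
    exact (primesEquiv (R := 𝓞 ℚ)).injective (Subtype.ext (h3.trans hℓ₃.symm))

/-! ### §2. The record sockets in prime-list form (`S` = the places over a list `L ∋ 3`) -/

/-- **Record socket, (M) rows, NO paid place** (n1011-p14's
`X4RankZero.bsdp_three_potMult_of_congr_of_places₆_of_primeList` over the seven-kind certificate):
`BSD(E,3)` for an X4 ∧ `r_an = 0` row `E = W`, potentially multiplicative at `3`, `ρ̄_{E,3}` onto,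
`ord₃ #Ш_an ≤ 2`, from a `3`-congruent partner `E′ = W′` of rank `≥ 1` whose place over every prime of
a list `L ∋ 3` supporting both discriminants is of kind (i), (ii), (iii), (iv′), (vi), (iii′) or (vii)
(`T = ∅`, budget `1 < 3^{rank E′}`). Displayed: the (M)-END's facts, A40/A41 `hU`/`hU2`, `hr`,
`hq`/`hv`, `θ`/`hθ`, `hrank` — EVIDENCE columns of a record; closes nothing beyond them.
[cite: CremonaMazur2000, §3 and Table 1] [cite: AgasheStein2002, Thm. 3.1]
[cite: SilvermanATAEC1994, Ch. V Lemma 5.2 (c), Thm. 5.3, Cor. 5.4]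
[cite: Delbourgo1998, Prop. 4 (p. 144)] -/
theorem X4RankZero.bsdp_three_potMult_of_congr_of_places₇_of_primeList
    (hKatoS : Kato2004.rankZero_padicValNat_sha_le_sub_localTamagawa_of_additive_potGood_of_imageContainsSL2)
    (hDel : Delbourgo1998.prop4_rankZero_pow_dvd_constantCoeff)
    (hGZK : rank_eq_analyticRank_of_analyticRank_le_one) (hmod : hasEntireLFunction_rat)
    (hmodD : nonempty_modularParametrizationData)
    (hKatoχ : Wuthrich2014.kato_halfEigenCharIdeal_dvd_cyclotomicPrime_of_surjective)
    (hCT : exists_casselsTate_pairing (K := ℚ))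
    (hU : Silverman1994_thmV53_tateUniformisation.{0})
    (hU2 : Silverman1994_thmV53_corV54_tateUniformisation.{0})
    (W : WeierstrassCurve ℚ) [W.IsElliptic] [W.IsGloballyMinimal] (hr : W.analyticRank = 0)
    (hX : haveI : Fact (Nat.Prime 3) := ⟨Nat.prime_three⟩; ClassX4 W 3)
    (hsurj : W.HasSurjectiveModNGaloisRep 3) (hj : padicValRat 3 W.j < 0)
    {q : ℚ} (hq : shaAn W = (q : ℂ)) (hv : padicValRat 3 q ≤ 2)
    (W' : WeierstrassCurve ℚ) [W'.IsElliptic]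
    (θ : geomTorsion W' ((3 : ℕ) : ℤ) ≃+ geomTorsion W ((3 : ℕ) : ℤ))
    (hθ : ∀ (σ : Field.absoluteGaloisGroup ℚ) (P : geomTorsion W' ((3 : ℕ) : ℤ)),
      θ (σ • P) = σ • θ P)
    (hrank : 1 ≤ W'.mordellWeilRank)
    {E₀ F₀ : WeierstrassCurve ℤ} (hE : E₀.map (Int.castRingHom ℚ) = W)
    (hF : F₀.map (Int.castRingHom ℚ) = W') (L : List ℕ) (h3L : 3 ∈ L)
    (hΔE : ∀ q : ℕ, q.Prime → (q : ℤ) ∣ E₀.Δ → q ∈ L)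
    (hΔF : ∀ q : ℕ, q.Prime → (q : ℤ) ∣ F₀.Δ → q ∈ L)
    (hplaces : ∀ w : HeightOneSpectrum (𝓞 ℚ), (primesEquiv w : ℕ) ∈ L →
      (((3 : ℕ) : 𝓞 ℚ) ∉ w.asIdeal ∧ Nat.card (nsmulAddMonoidHom 3 :
          (W'.baseChange (w.adicCompletion ℚ)).toAffine.Point →+ _).ker = 1) ∨
      (W.HasSplitMultiplicativeReductionAt w ∧ W'.HasSplitMultiplicativeReductionAt w ∧
        Nat.card (nsmulAddMonoidHom 3 :
          (W.baseChange (w.adicCompletion ℚ)).toAffine.Point →+ _).ker ≤ 3) ∨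
      (W.HasMultiplicativeReductionAt w ∧ W'.HasMultiplicativeReductionAt w ∧
        (∃ r : w.adicCompletion ℚ, algebraMap ℚ (w.adicCompletion ℚ) (-(W.c₄ / W.c₆)) =
          r ^ 2 * algebraMap ℚ (w.adicCompletion ℚ) (-(W'.c₄ / W'.c₆))) ∧
        (∀ ζ : w.adicCompletion ℚ, ζ ^ 3 = 1 → ζ = 1)) ∨
      (W.HasMultiplicativeReductionAt w ∧
        ¬ IsSquare (algebraMap ℚ (w.adicCompletion ℚ) (-(W.c₄ / W.c₆))) ∧
        W'.HasGoodReductionAt w ∧ ((3 : ℕ) : 𝓞 ℚ) ∉ w.asIdeal) ∨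
      (W.HasGoodReductionAt w ∧ W'.HasMultiplicativeReductionAt w ∧
        ¬ IsSquare (algebraMap ℚ (w.adicCompletion ℚ) (-(W'.c₄ / W'.c₆))) ∧
        ((3 : ℕ) : 𝓞 ℚ) ∉ w.asIdeal) ∨
      (1 < w.valuation ℚ W.j ∧ 1 < w.valuation ℚ W'.j ∧
        (∃ r : w.adicCompletion ℚ, algebraMap ℚ (w.adicCompletion ℚ) (-(W.c₄ / W.c₆)) =
          r ^ 2 * algebraMap ℚ (w.adicCompletion ℚ) (-(W'.c₄ / W'.c₆))) ∧
        (∀ ζ : w.adicCompletion ℚ, ζ ^ 3 = 1 → ζ = 1)) ∨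
      (W.HasAdditiveReductionAt w ∧ W'.HasAdditiveReductionAt w ∧ ((3 : ℕ) : 𝓞 ℚ) ∉ w.asIdeal ∧
        Nat.card (nsmulAddMonoidHom 3 :
          (W'.baseChange (w.adicCompletion ℚ)).toAffine.Point →+ _).ker = 3)) :
    haveI : Fact (Nat.Prime 3) := ⟨Nat.prime_three⟩
    BSDp W 3 := by
  haveI : Fact (Nat.Prime 3) := ⟨Nat.prime_three⟩
  obtain ⟨S, hS⟩ := exists_placeFinset_of_primeList L
  refine X4RankZero.bsdp_three_potMult_of_congr_of_places₇ hKatoS hDel hGZK hmod hmodD hKatoχ hCT W hr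
    hX hsurj hj hq hv hU hU2 W' θ hθ S ∅ (Finset.empty_subset S)
    (good_and_not_mem_of_not_mem_placeFinset hE hF L Nat.prime_three h3L hΔE hΔF hS) ?_
    (fun w hw _ ↦ hplaces w ((hS w).mp hw))
  rw [Finset.prod_empty]
  exact Nat.one_lt_pow (by omega) (by norm_num)

/-- **Record socket, (M) rows, the place `3` PAID** (the PASS⁺ / D44 shape of route planner 1,
ROUTE-1 §41.9 / §44): as `…_of_places₇_of_primeList`, but the place `3` itself is paid —
`#E′(ℚ₃)[3] ≤ t` (a records certificate) against the budget `3t < 3^k`, `k ≤ rank E′(ℚ)` — and every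
OTHER place over `L` is of one of the seven kinds. [cite: CremonaMazur2000, §3 and Table 1]
[cite: AgasheStein2002, Thm. 3.1] [cite: SilvermanATAEC1994, Ch. V Lemma 5.2 (c), Thm. 5.3, Cor. 5.4]
[cite: Delbourgo1998, Prop. 4 (p. 144)] -/
theorem X4RankZero.bsdp_three_potMult_of_congr_of_places₇_of_primeList_paidThree
    (hKatoS : Kato2004.rankZero_padicValNat_sha_le_sub_localTamagawa_of_additive_potGood_of_imageContainsSL2)
    (hDel : Delbourgo1998.prop4_rankZero_pow_dvd_constantCoeff)
    (hGZK : rank_eq_analyticRank_of_analyticRank_le_one) (hmod : hasEntireLFunction_rat)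
    (hmodD : nonempty_modularParametrizationData)
    (hKatoχ : Wuthrich2014.kato_halfEigenCharIdeal_dvd_cyclotomicPrime_of_surjective)
    (hCT : exists_casselsTate_pairing (K := ℚ))
    (hU : Silverman1994_thmV53_tateUniformisation.{0})
    (hU2 : Silverman1994_thmV53_corV54_tateUniformisation.{0})
    (W : WeierstrassCurve ℚ) [W.IsElliptic] [W.IsGloballyMinimal] (hr : W.analyticRank = 0)
    (hX : haveI : Fact (Nat.Prime 3) := ⟨Nat.prime_three⟩; ClassX4 W 3)
    (hsurj : W.HasSurjectiveModNGaloisRep 3) (hj : padicValRat 3 W.j < 0)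
    {q : ℚ} (hq : shaAn W = (q : ℂ)) (hv : padicValRat 3 q ≤ 2)
    (W' : WeierstrassCurve ℚ) [W'.IsElliptic]
    (θ : geomTorsion W' ((3 : ℕ) : ℤ) ≃+ geomTorsion W ((3 : ℕ) : ℤ))
    (hθ : ∀ (σ : Field.absoluteGaloisGroup ℚ) (P : geomTorsion W' ((3 : ℕ) : ℤ)),
      θ (σ • P) = σ • θ P)
    {t k : ℕ} (htors₃ : ∀ w : HeightOneSpectrum (𝓞 ℚ), (primesEquiv w : ℕ) = 3 →
      Nat.card (nsmulAddMonoidHom 3 :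
        (W'.baseChange (w.adicCompletion ℚ)).toAffine.Point →+ _).ker ≤ t)
    (hbudget : 3 * t < 3 ^ k) (hrank : k ≤ W'.mordellWeilRank)
    {E₀ F₀ : WeierstrassCurve ℤ} (hE : E₀.map (Int.castRingHom ℚ) = W)
    (hF : F₀.map (Int.castRingHom ℚ) = W') (L : List ℕ) (h3L : 3 ∈ L)
    (hΔE : ∀ q : ℕ, q.Prime → (q : ℤ) ∣ E₀.Δ → q ∈ L)
    (hΔF : ∀ q : ℕ, q.Prime → (q : ℤ) ∣ F₀.Δ → q ∈ L)
    (hplaces : ∀ w : HeightOneSpectrum (𝓞 ℚ), (primesEquiv w : ℕ) ∈ L → (primesEquiv w : ℕ) ≠ 3 →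
      (((3 : ℕ) : 𝓞 ℚ) ∉ w.asIdeal ∧ Nat.card (nsmulAddMonoidHom 3 :
          (W'.baseChange (w.adicCompletion ℚ)).toAffine.Point →+ _).ker = 1) ∨
      (W.HasSplitMultiplicativeReductionAt w ∧ W'.HasSplitMultiplicativeReductionAt w ∧
        Nat.card (nsmulAddMonoidHom 3 :
          (W.baseChange (w.adicCompletion ℚ)).toAffine.Point →+ _).ker ≤ 3) ∨
      (W.HasMultiplicativeReductionAt w ∧ W'.HasMultiplicativeReductionAt w ∧
        (∃ r : w.adicCompletion ℚ, algebraMap ℚ (w.adicCompletion ℚ) (-(W.c₄ / W.c₆)) =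
          r ^ 2 * algebraMap ℚ (w.adicCompletion ℚ) (-(W'.c₄ / W'.c₆))) ∧
        (∀ ζ : w.adicCompletion ℚ, ζ ^ 3 = 1 → ζ = 1)) ∨
      (W.HasMultiplicativeReductionAt w ∧
        ¬ IsSquare (algebraMap ℚ (w.adicCompletion ℚ) (-(W.c₄ / W.c₆))) ∧
        W'.HasGoodReductionAt w ∧ ((3 : ℕ) : 𝓞 ℚ) ∉ w.asIdeal) ∨
      (W.HasGoodReductionAt w ∧ W'.HasMultiplicativeReductionAt w ∧
        ¬ IsSquare (algebraMap ℚ (w.adicCompletion ℚ) (-(W'.c₄ / W'.c₆))) ∧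
        ((3 : ℕ) : 𝓞 ℚ) ∉ w.asIdeal) ∨
      (1 < w.valuation ℚ W.j ∧ 1 < w.valuation ℚ W'.j ∧
        (∃ r : w.adicCompletion ℚ, algebraMap ℚ (w.adicCompletion ℚ) (-(W.c₄ / W.c₆)) =
          r ^ 2 * algebraMap ℚ (w.adicCompletion ℚ) (-(W'.c₄ / W'.c₆))) ∧
        (∀ ζ : w.adicCompletion ℚ, ζ ^ 3 = 1 → ζ = 1)) ∨
      (W.HasAdditiveReductionAt w ∧ W'.HasAdditiveReductionAt w ∧ ((3 : ℕ) : 𝓞 ℚ) ∉ w.asIdeal ∧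
        Nat.card (nsmulAddMonoidHom 3 :
          (W'.baseChange (w.adicCompletion ℚ)).toAffine.Point →+ _).ker = 3)) :
    haveI : Fact (Nat.Prime 3) := ⟨Nat.prime_three⟩
    BSDp W 3 := by
  haveI : Fact (Nat.Prime 3) := ⟨Nat.prime_three⟩
  obtain ⟨S, hS⟩ := exists_placeFinset_of_primeList L
  obtain ⟨T, hTS, hT, hT3⟩ := exists_paidPlace_three W' L h3L hS htors₃ hbudget hrank
  exact X4RankZero.bsdp_three_potMult_of_congr_of_places₇ hKatoS hDel hGZK hmod hmodD hKatoχ hCT W hr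
    hX hsurj hj hq hv hU hU2 W' θ hθ S T hTS
    (good_and_not_mem_of_not_mem_placeFinset hE hF L Nat.prime_three h3L hΔE hΔF hS) hT
    (fun w hw hwT ↦ hplaces w ((hS w).mp hw) (hT3 w hw hwT))

/-- **Record socket, potentially GOOD rows (Kato's upper half), the place `3` PAID** (for an
additive potentially good `E` at `3` no kind frees the place `3`: (ii) / (iii) / (iii′) want `E`
multiplicative or `|j(E)|₃ > 1` there): `BSD(E,3)` for an X4 ∧ `r_an = 0` row, `ord₃ j(E) ≥ 0`, the
`3`-adic tower onto, `3 ∤ ∏ c_ℓ(E)`, a parametrisation datum with `3 ∤ c_D`, `ord₃ #Ш_an ≤ 2`, from a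
`3`-congruent partner with `#E′(ℚ₃)[3] ≤ t`, `3t < 3^k`, `k ≤ rank E′(ℚ)`, every other place over
`L ∋ 3` of one of the seven kinds. [cite: CremonaMazur2000, §3 and Table 1]
[cite: AgasheStein2002, Thm. 3.1] [cite: Kato2004Asterisque, Thm. 14.5 (3) (p. 236)]
[cite: SilvermanAEC2009, Thm. X.4.14] -/
theorem X4RankZero.bsdp_three_of_congr_of_places₇_of_kato_of_primeList_paidThree
    (hKato : Kato2004.rankZero_padicValNat_sha_le_of_additive_potGood_of_imageContainsSL2)
    (hCT : exists_casselsTate_pairing (K := ℚ))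
    (hGZK : rank_eq_analyticRank_of_analyticRank_le_one) (hmod : hasEntireLFunction_rat)
    (hU : Silverman1994_thmV53_tateUniformisation.{0})
    (hU2 : Silverman1994_thmV53_corV54_tateUniformisation.{0})
    (W : WeierstrassCurve ℚ) [W.IsElliptic] [W.IsGloballyMinimal]
    (hr : W.analyticRank = 0) (hX : haveI : Fact (Nat.Prime 3) := ⟨Nat.prime_three⟩; ClassX4 W 3)
    (hpot : 0 ≤ padicValRat 3 W.j)
    (hsurj : ∀ n : ℕ, W.HasSurjectiveModNGaloisRep (3 ^ n : ℕ)) (htam : ¬ 3 ∣ W.tamagawaProduct)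
    {N : ℕ} [NeZero N] (D : ModularParametrizationData W N) (hc : ¬ (3 : ℤ) ∣ D.maninConstant)
    {q : ℚ} (hq : shaAn W = (q : ℂ)) (hv : padicValRat 3 q ≤ 2)
    (W' : WeierstrassCurve ℚ) [W'.IsElliptic]
    (θ : geomTorsion W' ((3 : ℕ) : ℤ) ≃+ geomTorsion W ((3 : ℕ) : ℤ))
    (hθ : ∀ (σ : Field.absoluteGaloisGroup ℚ) (P : geomTorsion W' ((3 : ℕ) : ℤ)),
      θ (σ • P) = σ • θ P)
    {t k : ℕ} (htors₃ : ∀ w : HeightOneSpectrum (𝓞 ℚ), (primesEquiv w : ℕ) = 3 →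
      Nat.card (nsmulAddMonoidHom 3 :
        (W'.baseChange (w.adicCompletion ℚ)).toAffine.Point →+ _).ker ≤ t)
    (hbudget : 3 * t < 3 ^ k) (hrank : k ≤ W'.mordellWeilRank)
    {E₀ F₀ : WeierstrassCurve ℤ} (hE : E₀.map (Int.castRingHom ℚ) = W)
    (hF : F₀.map (Int.castRingHom ℚ) = W') (L : List ℕ) (h3L : 3 ∈ L)
    (hΔE : ∀ q : ℕ, q.Prime → (q : ℤ) ∣ E₀.Δ → q ∈ L)
    (hΔF : ∀ q : ℕ, q.Prime → (q : ℤ) ∣ F₀.Δ → q ∈ L)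
    (hplaces : ∀ w : HeightOneSpectrum (𝓞 ℚ), (primesEquiv w : ℕ) ∈ L → (primesEquiv w : ℕ) ≠ 3 →
      (((3 : ℕ) : 𝓞 ℚ) ∉ w.asIdeal ∧ Nat.card (nsmulAddMonoidHom 3 :
          (W'.baseChange (w.adicCompletion ℚ)).toAffine.Point →+ _).ker = 1) ∨
      (W.HasSplitMultiplicativeReductionAt w ∧ W'.HasSplitMultiplicativeReductionAt w ∧
        Nat.card (nsmulAddMonoidHom 3 :
          (W.baseChange (w.adicCompletion ℚ)).toAffine.Point →+ _).ker ≤ 3) ∨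
      (W.HasMultiplicativeReductionAt w ∧ W'.HasMultiplicativeReductionAt w ∧
        (∃ r : w.adicCompletion ℚ, algebraMap ℚ (w.adicCompletion ℚ) (-(W.c₄ / W.c₆)) =
          r ^ 2 * algebraMap ℚ (w.adicCompletion ℚ) (-(W'.c₄ / W'.c₆))) ∧
        (∀ ζ : w.adicCompletion ℚ, ζ ^ 3 = 1 → ζ = 1)) ∨
      (W.HasMultiplicativeReductionAt w ∧
        ¬ IsSquare (algebraMap ℚ (w.adicCompletion ℚ) (-(W.c₄ / W.c₆))) ∧
        W'.HasGoodReductionAt w ∧ ((3 : ℕ) : 𝓞 ℚ) ∉ w.asIdeal) ∨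
      (W.HasGoodReductionAt w ∧ W'.HasMultiplicativeReductionAt w ∧
        ¬ IsSquare (algebraMap ℚ (w.adicCompletion ℚ) (-(W'.c₄ / W'.c₆))) ∧
        ((3 : ℕ) : 𝓞 ℚ) ∉ w.asIdeal) ∨
      (1 < w.valuation ℚ W.j ∧ 1 < w.valuation ℚ W'.j ∧
        (∃ r : w.adicCompletion ℚ, algebraMap ℚ (w.adicCompletion ℚ) (-(W.c₄ / W.c₆)) =
          r ^ 2 * algebraMap ℚ (w.adicCompletion ℚ) (-(W'.c₄ / W'.c₆))) ∧
        (∀ ζ : w.adicCompletion ℚ, ζ ^ 3 = 1 → ζ = 1)) ∨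
      (W.HasAdditiveReductionAt w ∧ W'.HasAdditiveReductionAt w ∧ ((3 : ℕ) : 𝓞 ℚ) ∉ w.asIdeal ∧
        Nat.card (nsmulAddMonoidHom 3 :
          (W'.baseChange (w.adicCompletion ℚ)).toAffine.Point →+ _).ker = 3)) :
    haveI : Fact (Nat.Prime 3) := ⟨Nat.prime_three⟩
    BSDp W 3 := by
  haveI : Fact (Nat.Prime 3) := ⟨Nat.prime_three⟩
  obtain ⟨S, hS⟩ := exists_placeFinset_of_primeList L
  obtain ⟨T, hTS, hT, hT3⟩ := exists_paidPlace_three W' L h3L hS htors₃ hbudget hrank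
  exact X4RankZero.bsdp_three_of_congr_of_places₇_of_kato hKato hCT hGZK hmod W hr hX hpot hsurj htam D
    hc hq hv hU hU2 W' θ hθ S T hTS
    (good_and_not_mem_of_not_mem_placeFinset hE hF L Nat.prime_three h3L hΔE hΔF hS) hT
    (fun w hw hwT ↦ hplaces w ((hS w).mp hw) (hT3 w hw hwT))

end Summit.BirchSwinnertonDyer.Rank1Residual.Additive

end
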